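import Summits.ABC.IUTFork.Repair.RHReachLedgerDoorGenuineTiesUnit
import Mathlib.NumberTheory.LegendreSymbol.QuadraticChar.Basic
import HarnessLib

/-!
# D-0079 RESCUE sub-cell R-H, TIE-DECIDER lane (rows 15 / 20 / 27): `√−1 ∈ K` FORCES EVEN RESIDUE DEGREE over every `p ≡ 3 (mod 4)` —
# the (O″) clause «`f(𝔭_x∣p) ≥ 2`» of the row-27 door holds at such primes for EVERY genuine datum; the λ₇ @ `l = 41`, `p = 1231` survivor

PROOF-ONLY file (0 definitions, 0 `Prop` facts; abc-iut cell, D-0079 RESCUE sub-cell R-H, rung LADDER-ABC:A2.RESCUE.H; seat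
abc-iut-rh-typ-12 gen 5, round-1 pair-12 base, TIE-DECIDER lane). TAKES NO SIDE on [IUTchIII] Cor. 3.12 or on any author; row 27's
ledger `RH.ReachLedger.HStarReachLedgerK` (abc-iut-lens-nearmiss-1, p464022) is an R-H CANDIDATE = a HYPOTHESIS SHAPE, never asserted;
typed ≠ proved; nothing here asserts abc proved or refuted.

THE QUESTION (abc-iut-rh2-q3-num Q3-TIE27-v1.tsv 30af8025d2a3c782, 2026-08-27T01:22:01Z; abc-iut-rh2-L1 01:29:36Z / 01:34:44Z): after
`ReachLedgerDoor.statement_pilotDataOfK_of_hStarReachLedgerK_of_innerOuterUnit` (p483260) the residual of row 27's certificate binder is a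
bad prime `p` of cyclotomic index `e_p = p^a(p−1)` carrying a place `x` of residue degree `1` of CYCLOTOMIC TYPE; on the 258-datum Q3
universe exactly ONE (datum, l, type) triple can carry a tied bad prime: λ₇ (`λ = 1/2 + 2/7^7`) at `l = 41`, `p = 1231`, `e_w = 1230 = p − 1`
(candidate type `e_v = 30`). THE DECISION, STRUCTURAL (no numerics, no unit test, no `m_x` bit): `1231 = 4·307 + 3 ≡ 3 (mod 4)`, and at
EVERY genuine datum `√−1 ∈ F ⊆ K` ([IUTchI] Def. 3.1 (a), the FIELD `InitialThetaData.sqrt_neg_one_mem` of the tree's typed datum); the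
image of `√−1` in a residue field `𝓞_K/𝔭_x` (`x ∣ p`, `#(𝓞_K/𝔭_x) = p^{f_x}`) is a square root of `−1`, and `−1` is a square in a finite
field iff its cardinality is `≢ 3 (mod 4)` (Mathlib `FiniteField.isSquare_neg_one_iff`); for `p ≡ 3 (mod 4)` and `f_x` odd,
`p^{f_x} ≡ 3 (mod 4)` — so `f_x` is EVEN, in particular `f(𝔭_x∣p) ≥ 2` at EVERY place `x ∣ p`. Hence the per-place disjunct «`f ≥ 2`» of
(O″) holds at every bad prime `p ≡ 3 (mod 4)` of every genuine datum, whatever its index; the λ₇ triple is NOT residual. PROVED: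

* §0 arithmetic: `pow_mod_four_eq_three_of_odd`; `two_dvd_of_isSquare_neg_one` (finite field of cardinality `p^f`, `p ≡ 3 (mod 4)`,
  `−1` a square ⇒ `2 ∣ f`); `four_dvd_of_odd_mul_eq_pred` (a tie `l·e_v = p − 1` at `p ≡ 1 (mod 4)` with `l` odd forces `4 ∣ e_v`).
* §1 number fields: `exists_ringOfIntegers_sq_eq_neg_one`; **`two_dvd_inertiaDeg_of_sq_eq_neg_one`** (`i ∈ 𝓞_K`, `i² = −1`,
  `p ≡ 3 (mod 4)`, `𝔭 ∣ p` ⇒ `2 ∣ f(𝔭∣p)`), `two_le_inertiaDeg_of_sq_eq_neg_one`.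
* §2 the genuine bed `D : InitialThetaData F K F̄ E l Pb`, `X := pilotDataOfK D K`: `InitialThetaData.exists_sq_eq_neg_one_K`,
  **`InitialThetaData.two_le_inertiaDeg_placeOf_of_mod_four_eq_three`** (every fibre point `x` over `p ≡ 3 (mod 4)` has `f ≥ 2`),
  `…two_le_residueDegree_kOf_of_mod_four_eq_three` (the same for abc-iut-S7's `residueDegree p (kOf X p x)`), and the (O″)-supplier
  **`InitialThetaData.outerUnit_clause_of_mod_four_eq_three`** (the disjunction of p483260's `hO`, for ANY index `e`, at `p ≡ 3 (mod 4)`).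
* §3 the numeral: `Nat.Prime 1231`, `1231 % 4 = 3`, **`InitialThetaData.two_le_inertiaDeg_placeOf_1231`** and
  `InitialThetaData.outerUnit_clause_1231` — the λ₇ @ `l = 41`, `p = 1231` triple of Q3-TIE27-v1 is decided for every type.
* §4 **`statement_pilotDataOfK_of_hStarReachLedgerK_of_innerOuterUnit_modFour`** — abc-iut-rh2-L1's door p483260 VERBATIM with (O″) owed
  ONLY at the bad primes `p ≢ 3 (mod 4)`.
So the kernel-exact residual of row 27's certificate binder is: a bad prime `p ≡ 1 (mod 4)` of cyclotomic index `e_p = p^a(p−1)` carrying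
a residue-degree-`1` place of cyclotomic type (and on a genuine tower `e_w = l·e_v = p − 1` with `l` odd then needs `4 ∣ e_v`, §0).
HONEST SCOPE: classical algebra (Gaussian reciprocity supplement) + the tree's typed genuine datum; every R-H candidate remains a HYPOTHESIS.
[cite: NeukirchANT1999, Ch. I §8, Ch. II Prop. (6.8)] [cite: IrelandRosen1990, Ch. 7 §1 Thm. 1 (𝔽_q^× is cyclic), Ch. 5 §1
Prop. 5.1.2] [cite: Mochizuki2012, IUTchI Def. 3.1 (a),(b) p. 61; IUTchIII Cor. 3.12 p. 173–174] [claim: Mochizuki2012, status: disputed]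
-/

noncomputable section

open Set Function Metric NumberField IsDedekindDomain
open scoped Pointwise

namespace Summit.ABC.IUTFork.Repair.RH.TieDecider

open Thm311 Thm311.Real Cor312 Cor312.Setting Cor312Vol Cor312Prov Literature.IUT.LogThetaLattice Literature.IUT.LogVolume
  Literature.IUT.HodgeTheaters Summit.ABC.IUTFork.Repair.RH.ReachLedger Summit.ABC.IUTFork.Repair.RH.ReachLedgerDoor
open Literature.NumberTheory.NumberFields
open Literature.NumberTheory.GaloisRepresentations.Ultrametric

/-! ## §0. Arithmetic mod `4` -/

section Arith

/-- `p ≡ 3 (mod 4)` and `f` odd ⇒ `p^f ≡ 3 (mod 4)` (`p² ≡ 1`). [cite: IrelandRosen1990, Ch. 5 §1 Prop. 5.1.2] -/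
theorem pow_mod_four_eq_three_of_odd {p f : ℕ} (hp : p % 4 = 3) (hf : Odd f) : p ^ f % 4 = 3 := by
  obtain ⟨m, rfl⟩ := hf
  have h2 : p ^ 2 % 4 = 1 := by rw [Nat.pow_mod, hp]
  have h2m : (p ^ 2) ^ m % 4 = 1 := by rw [Nat.pow_mod, h2, one_pow]; norm_num
  rw [pow_succ, pow_mul, Nat.mul_mod, h2m, hp]

/-- **`−1` a square in a finite field of cardinality `p^f` with `p ≡ 3 (mod 4)` forces `f` EVEN** (`−1` is a square iff `#k ≢ 3 (mod 4)`,
Mathlib `FiniteField.isSquare_neg_one_iff`). [cite: IrelandRosen1990, Ch. 7 §1 Thm. 1, Ch. 5 §1 Prop. 5.1.2] -/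
theorem two_dvd_of_isSquare_neg_one {k : Type*} [Field k] [Fintype k] {p f : ℕ} (hp : p % 4 = 3)
    (hcard : Fintype.card k = p ^ f) (hsq : IsSquare (-1 : k)) : 2 ∣ f := by
  by_contra hodd
  have hodd' : Odd f := Nat.odd_iff.mpr (Nat.two_dvd_ne_zero.mp hodd)
  have h := FiniteField.isSquare_neg_one_iff.mp hsq
  rw [hcard, pow_mod_four_eq_three_of_odd hp hodd'] at h
  exact h rfl

/-- An odd number is `≡ 1` or `≡ 3 (mod 4)`. [folklore] -/
theorem mod_four_eq_one_or_three_of_odd {p : ℕ} (hp : Odd p) : p % 4 = 1 ∨ p % 4 = 3 :=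
  Nat.odd_mod_four_iff.mp (Nat.odd_iff.mp hp)

/-- **On a genuine tower a tie off `p ≡ 3 (mod 4)` needs `4 ∣ e_v`**: if `l` is odd, `p ≡ 1 (mod 4)` and `l·e = p − 1`, then `4 ∣ e`.
(abc-iut-rh2-q3-num 01:22:01Z: on a genuine tower `e_w = l·e_v`, so a cyclotomic index `e_w = p^a(p−1)` with `l ≠ p` forces `a = 0`,
`l·e_v = p − 1`.) [folklore] -/
theorem four_dvd_of_odd_mul_eq_pred {l e p : ℕ} (hl : Odd l) (hp : p % 4 = 1) (h : l * e = p - 1) : 4 ∣ e := by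
  have h4 : 4 ∣ p - 1 := by omega
  rw [← h] at h4
  have hcop : Nat.Coprime 4 l := by
    have h2 : Nat.Coprime 2 l := hl.coprime_two_left
    simpa using h2.pow_left 2
  exact hcop.dvd_of_dvd_mul_left h4

end Arith

/-! ## §1. Number fields containing `√−1`: even residue degree over `p ≡ 3 (mod 4)` -/

section NumberFields

variable {K : Type} [Field K] [NumberField K]

omit [NumberField K] in
/-- `√−1 ∈ K` is an algebraic integer: `∃ i ∈ 𝓞_K, i² = −1`. [cite: NeukirchANT1999, Ch. I §2] -/
theorem exists_ringOfIntegers_sq_eq_neg_one (h : ∃ i : K, i ^ 2 = -1) : ∃ i : 𝓞 K, i ^ 2 = -1 := by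
  obtain ⟨i, hi⟩ := h
  have h4 : i ^ 4 = 1 := by
    rw [show (4 : ℕ) = 2 * 2 from rfl, pow_mul, hi]; norm_num
  have hint : IsIntegral ℤ i := IsIntegral.of_pow (by norm_num : 0 < 4) (by rw [h4]; exact isIntegral_one)
  refine ⟨⟨i, show i ∈ integralClosure ℤ K from hint⟩, RingOfIntegers.ext ?_⟩
  simp [hi]

/-- **`i ∈ 𝓞_K` with `i² = −1` and `p ≡ 3 (mod 4)` ⇒ `f(𝔭∣p)` is EVEN at every prime `𝔭 ∣ p` of `K`.** The residue field `𝓞_K/𝔭` has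
`p^{f(𝔭∣p)}` elements (`𝐍𝔭 = p^f`) and contains the square root `ī` of `−1`; `−1` is a square in a finite field iff its cardinality is
`≢ 3 (mod 4)`. [cite: NeukirchANT1999, Ch. I §8] [cite: IrelandRosen1990, Ch. 7 §1 Thm. 1, Ch. 5 §1 Prop. 5.1.2] -/
theorem two_dvd_inertiaDeg_of_sq_eq_neg_one {i : 𝓞 K} (hi : i ^ 2 = -1) (p : ℕ) [Fact p.Prime] (hp4 : p % 4 = 3)
    (v : HeightOneSpectrum (𝓞 K)) (hv : ((p : ℕ) : 𝓞 K) ∈ v.asIdeal) : 2 ∣ v.asIdeal.inertiaDeg ℤ := by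
  haveI : v.asIdeal.IsMaximal := v.isMaximal
  letI : Field (𝓞 K ⧸ v.asIdeal) := Ideal.Quotient.field v.asIdeal
  letI : Fintype (𝓞 K ⧸ v.asIdeal) := Fintype.ofFinite _
  have hN := absNorm_eq_pow_inertiaDeg K p v hv
  rw [Ideal.absNorm_apply, Submodule.cardQuot_apply] at hN
  have hcard : Fintype.card (𝓞 K ⧸ v.asIdeal) = p ^ v.asIdeal.inertiaDeg ℤ := Fintype.card_eq_nat_card.trans hN
  have hsq : IsSquare (-1 : 𝓞 K ⧸ v.asIdeal) :=
    ⟨Ideal.Quotient.mk v.asIdeal i, by rw [← sq, ← map_pow, hi, map_neg, map_one]⟩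
  exact two_dvd_of_isSquare_neg_one hp4 hcard hsq

/-- … hence `f(𝔭∣p) ≥ 2`. [cite: NeukirchANT1999, Ch. I §8] -/
theorem two_le_inertiaDeg_of_sq_eq_neg_one {i : 𝓞 K} (hi : i ^ 2 = -1) (p : ℕ) [Fact p.Prime] (hp4 : p % 4 = 3)
    (v : HeightOneSpectrum (𝓞 K)) (hv : ((p : ℕ) : 𝓞 K) ∈ v.asIdeal) : 2 ≤ v.asIdeal.inertiaDeg ℤ := by
  haveI : v.asIdeal.IsMaximal := v.isMaximal
  exact Nat.le_of_dvd (Ideal.inertiaDeg_pos v.asIdeal ℤ) (two_dvd_inertiaDeg_of_sq_eq_neg_one hi p hp4 v hv)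

/-- The same for abc-iut-S7's norm-defined residue degree of the rescaled completion `K_v`: `2 ∣ f(K_v)` and `2 ≤ f(K_v)`.
[cite: NeukirchANT1999, Ch. II Prop. (6.8)] -/
theorem two_dvd_residueDegree_rescaledCompletion_of_sq_eq_neg_one {i : 𝓞 K} (hi : i ^ 2 = -1) (p : ℕ) [Fact p.Prime]
    (hp4 : p % 4 = 3) (v : HeightOneSpectrum (𝓞 K)) (hv : ((p : ℕ) : 𝓞 K) ∈ v.asIdeal) :
    2 ∣ residueDegree p (RescaledCompletion K p v hv) ∧ 2 ≤ residueDegree p (RescaledCompletion K p v hv) := by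
  rw [residueDegree_rescaledCompletion K p v hv]
  exact ⟨two_dvd_inertiaDeg_of_sq_eq_neg_one hi p hp4 v hv, two_le_inertiaDeg_of_sq_eq_neg_one hi p hp4 v hv⟩

end NumberFields

/-! ## §2. The genuine bed: `√−1 ∈ F ⊆ K` ([IUTchI] Def. 3.1 (a)) -/

section Bed

variable {F K Fbar : Type} [Field F] [NumberField F] [Field K] [NumberField K] [Algebra F K] [Field Fbar]
  [Algebra F Fbar] [Algebra K Fbar] {E : WeierstrassCurve F} [E.IsElliptic] {l : ℕ} {Pb : BadPlacePredicates K}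
  (D : InitialThetaData F K Fbar E l Pb)

include D in
/-- **`√−1 ∈ K`** at a genuine datum: [IUTchI] Def. 3.1 (a) «`F` is a number field such that `√−1 ∈ F`» pushed along `F → K`.
[cite: Mochizuki2012, IUTchI Def. 3.1 (a) p. 61] [claim: Mochizuki2012, status: disputed] -/
theorem _root_.Literature.IUT.HodgeTheaters.InitialThetaData.exists_sq_eq_neg_one_K : ∃ i : K, i ^ 2 = -1 := by
  obtain ⟨i, hi⟩ := D.sqrt_neg_one_mem
  exact ⟨algebraMap F K i, by rw [← map_pow, hi, map_neg, map_one]⟩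

include D in
/-- … as an algebraic integer of `K`. [cite: Mochizuki2012, IUTchI Def. 3.1 (a) p. 61] [claim: Mochizuki2012, status: disputed] -/
theorem _root_.Literature.IUT.HodgeTheaters.InitialThetaData.exists_ringOfIntegers_sq_eq_neg_one_K : ∃ i : 𝓞 K, i ^ 2 = -1 :=
  exists_ringOfIntegers_sq_eq_neg_one D.exists_sq_eq_neg_one_K

include D in
/-- **At a genuine datum every prime `𝔭 ∣ p` of `K` with `p ≡ 3 (mod 4)` has EVEN residue degree.**
[cite: Mochizuki2012, IUTchI Def. 3.1 (a) p. 61] [cite: IrelandRosen1990, Ch. 7 §1 Thm. 1, Ch. 5 §1 Prop. 5.1.2] [claim: Mochizuki2012, status: disputed] -/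
theorem _root_.Literature.IUT.HodgeTheaters.InitialThetaData.two_dvd_inertiaDeg_of_mod_four_eq_three (p : ℕ) [Fact p.Prime]
    (hp4 : p % 4 = 3) (v : HeightOneSpectrum (𝓞 K)) (hv : ((p : ℕ) : 𝓞 K) ∈ v.asIdeal) : 2 ∣ v.asIdeal.inertiaDeg ℤ := by
  obtain ⟨i, hi⟩ := D.exists_ringOfIntegers_sq_eq_neg_one_K
  exact two_dvd_inertiaDeg_of_sq_eq_neg_one hi p hp4 v hv

/-- **THE TIE-DECIDER AT `p ≡ 3 (mod 4)`: every fibre point `x` of `X := pilotDataOfK D K` over such a prime has `f(𝔭_x∣p) ≥ 2`** — the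
(O″) per-place disjunct «`f ≥ 2`» of the row-27 door, with no unit test and no `m_x` bit.
[cite: Mochizuki2012, IUTchI Def. 3.1 (a) p. 61] [cite: NeukirchANT1999, Ch. I §8] [claim: Mochizuki2012, status: disputed] -/
theorem _root_.Literature.IUT.HodgeTheaters.InitialThetaData.two_le_inertiaDeg_placeOf_of_mod_four_eq_three (pp : Nat.Primes)
    (hp4 : (pp : ℕ) % 4 = 3) (x : (thetaIndex (pilotDataOfK D K)).Fibre (.inr pp)) :
    haveI : Fact (pp : ℕ).Prime := ⟨pp.2⟩
    2 ≤ (placeOf (pilotDataOfK D K) pp.1 x).asIdeal.inertiaDeg ℤ := by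
  haveI : Fact (pp : ℕ).Prime := ⟨pp.2⟩
  obtain ⟨i, hi⟩ := D.exists_ringOfIntegers_sq_eq_neg_one_K
  exact two_le_inertiaDeg_of_sq_eq_neg_one hi pp.1 hp4 _ (natCast_mem_placeOf (pilotDataOfK D K) pp.1 x)

/-- … and `2 ∣ f(𝔭_x∣p)` there. [cite: Mochizuki2012, IUTchI Def. 3.1 (a) p. 61] [claim: Mochizuki2012, status: disputed] -/
theorem _root_.Literature.IUT.HodgeTheaters.InitialThetaData.two_dvd_inertiaDeg_placeOf_of_mod_four_eq_three (pp : Nat.Primes)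
    (hp4 : (pp : ℕ) % 4 = 3) (x : (thetaIndex (pilotDataOfK D K)).Fibre (.inr pp)) :
    haveI : Fact (pp : ℕ).Prime := ⟨pp.2⟩
    2 ∣ (placeOf (pilotDataOfK D K) pp.1 x).asIdeal.inertiaDeg ℤ := by
  haveI : Fact (pp : ℕ).Prime := ⟨pp.2⟩
  exact D.two_dvd_inertiaDeg_of_mod_four_eq_three pp.1 hp4 _ (natCast_mem_placeOf (pilotDataOfK D K) pp.1 x)

/-- The same for abc-iut-S7's `residueDegree p (K_x)`, `K_x = kOf X p x` the rescaled completion: `f(K_x) ≥ 2`.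
[cite: NeukirchANT1999, Ch. II Prop. (6.8)] [claim: Mochizuki2012, status: disputed] -/
theorem _root_.Literature.IUT.HodgeTheaters.InitialThetaData.two_le_residueDegree_kOf_of_mod_four_eq_three (pp : Nat.Primes)
    (hp4 : (pp : ℕ) % 4 = 3) (x : (thetaIndex (pilotDataOfK D K)).Fibre (.inr pp)) :
    haveI : Fact (pp : ℕ).Prime := ⟨pp.2⟩
    2 ≤ residueDegree (pp : ℕ) (kOf (pilotDataOfK D K) pp.1 x) := by
  haveI : Fact (pp : ℕ).Prime := ⟨pp.2⟩
  rw [residueDegree_rescaledCompletion K pp.1 (placeOf (pilotDataOfK D K) pp.1 x) (natCast_mem_placeOf (pilotDataOfK D K) pp.1 x)]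
  exact D.two_le_inertiaDeg_placeOf_of_mod_four_eq_three pp hp4 x

/-- **THE (O″)-SUPPLIER AT `p ≡ 3 (mod 4)`.** For ANY index `e`, the disjunction «`e ≠ p^a(p−1)` for all `a`, OR for every `x ∣ p`:
`f(𝔭_x∣p) ≥ 2` or some `π ∈ K_x` with `‖π‖ = p^{−1/e}` and `‖1 + π^e/p‖ = 1`» — the hypothesis `hO` of abc-iut-rh2-L1's
`ReachLedgerDoor.statement_pilotDataOfK_of_hStarReachLedgerK_of_innerOuterUnit` (p483260) at the prime `p` — HOLDS, by its middle disjunct.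
[cite: Mochizuki2012, IUTchI Def. 3.1 (a) p. 61] [cite: NeukirchANT1999, Ch. II (5.5)–(5.7)] [claim: Mochizuki2012, status: disputed] -/
theorem _root_.Literature.IUT.HodgeTheaters.InitialThetaData.outerUnit_clause_of_mod_four_eq_three (pp : Nat.Primes)
    (hp4 : (pp : ℕ) % 4 = 3) (e : ℕ) :
    haveI : Fact (pp : ℕ).Prime := ⟨pp.2⟩
    (∀ a : ℕ, (e : ℤ) ≠ ((pp : ℕ) : ℤ) ^ a * (((pp : ℕ) : ℤ) - 1)) ∨
      ∀ x : (thetaIndex (pilotDataOfK D K)).Fibre (.inr pp), 2 ≤ (placeOf (pilotDataOfK D K) pp.1 x).asIdeal.inertiaDeg ℤ ∨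
        ∃ π : kOf (pilotDataOfK D K) pp.1 x, ‖π‖ = ((pp : ℕ) : ℝ) ^ (-(1 : ℝ) / (e : ℝ)) ∧
          ‖1 + π ^ e / ((pp : ℕ) : kOf (pilotDataOfK D K) pp.1 x)‖ = 1 :=
  Or.inr fun x => Or.inl (D.two_le_inertiaDeg_placeOf_of_mod_four_eq_three pp hp4 x)

end Bed

/-! ## §3. The numeral: the λ₇ @ `l = 41`, `p = 1231` survivor of Q3-TIE27-v1 -/

section Numeral

/-- `1231` is prime. [folklore] -/
theorem prime_1231 : Nat.Prime 1231 := by norm_num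

/-- `1231 = 4·307 + 3`. [folklore] -/
theorem mod_four_1231 : 1231 % 4 = 3 := by norm_num

/-- `1230 = 2·3·5·41 = 1231 − 1`: the tied index of Q3-TIE27-v1's survivor (`l·e_v = 41·30`). [folklore] -/
theorem tie_1231 : 41 * 30 = 1231 - 1 ∧ 2 * 3 * 5 * 41 = 1230 := by norm_num

variable {F K Fbar : Type} [Field F] [NumberField F] [Field K] [NumberField K] [Algebra F K] [Field Fbar]
  [Algebra F Fbar] [Algebra K Fbar] {E : WeierstrassCurve F} [E.IsElliptic] {l : ℕ} {Pb : BadPlacePredicates K}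
  (D : InitialThetaData F K Fbar E l Pb)

/-- **THE λ₇ SURVIVOR DECIDED**: at EVERY genuine datum (any `l`, any type) every place of `K` over `1231` has residue degree `≥ 2` — so at
`p = 1231` the row-27 door's (O″) holds by «`f ≥ 2`», and the one (datum, l, type) triple of abc-iut-rh2-q3-num's Q3-TIE27-v1 that could carry
a tied bad prime (λ₇ = `1/2 + 2/7^7`, `l = 41`, `e_w = 1230`) is NOT residual; no «cyclotomic type» / unit test / `m_x` question arises there.
[cite: Mochizuki2012, IUTchI Def. 3.1 (a) p. 61] [cite: IrelandRosen1990, Ch. 7 §1 Thm. 1, Ch. 5 §1 Prop. 5.1.2] [claim: Mochizuki2012, status: disputed] -/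
theorem _root_.Literature.IUT.HodgeTheaters.InitialThetaData.two_le_inertiaDeg_placeOf_1231
    (x : (thetaIndex (pilotDataOfK D K)).Fibre (.inr ⟨1231, prime_1231⟩)) :
    haveI : Fact (Nat.Prime 1231) := ⟨prime_1231⟩
    2 ≤ (placeOf (pilotDataOfK D K) 1231 x).asIdeal.inertiaDeg ℤ :=
  D.two_le_inertiaDeg_placeOf_of_mod_four_eq_three ⟨1231, prime_1231⟩ mod_four_1231 x

/-- … so (O″) at `p = 1231` holds for ANY index `e` (in particular at the tied `e = 1230`).
[cite: Mochizuki2012, IUTchI Def. 3.1 (a) p. 61] [claim: Mochizuki2012, status: disputed] -/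
theorem _root_.Literature.IUT.HodgeTheaters.InitialThetaData.outerUnit_clause_1231 (e : ℕ) :
    haveI : Fact (Nat.Prime 1231) := ⟨prime_1231⟩
    (∀ a : ℕ, (e : ℤ) ≠ ((1231 : ℕ) : ℤ) ^ a * (((1231 : ℕ) : ℤ) - 1)) ∨
      ∀ x : (thetaIndex (pilotDataOfK D K)).Fibre (.inr ⟨1231, prime_1231⟩),
        2 ≤ (placeOf (pilotDataOfK D K) 1231 x).asIdeal.inertiaDeg ℤ ∨
        ∃ π : kOf (pilotDataOfK D K) 1231 x, ‖π‖ = ((1231 : ℕ) : ℝ) ^ (-(1 : ℝ) / (e : ℝ)) ∧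
          ‖1 + π ^ e / ((1231 : ℕ) : kOf (pilotDataOfK D K) 1231 x)‖ = 1 :=
  D.outerUnit_clause_of_mod_four_eq_three ⟨1231, prime_1231⟩ mod_four_1231 e

end Numeral

/-! ## §4. The row-27 door with (O″) owed only at the bad primes `p ≢ 3 (mod 4)` -/

section Door

variable {F K Fbar : Type} [Field F] [NumberField F] [Field K] [NumberField K] [Algebra F K] [Field Fbar]
  [Algebra F Fbar] [Algebra K Fbar] {E : WeierstrassCurve F} [E.IsElliptic] {l : ℕ} {Pb : BadPlacePredicates K}
  (D : InitialThetaData F K Fbar E l Pb) {logv : PadicLogs K} (hlog : LogvAnalytic logv)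
  (M : Type) [Field M] [NumberField M]
  (archPk : ∀ (j : (thetaIndex (pilotDataOfK D K)).Label) (vQ : (thetaIndex (pilotDataOfK D K)).VQ),
    Set ((logShellsDH (pilotDataOfK D K) logv).Packet j vQ))
  (archSub : ∀ (j : (thetaIndex (pilotDataOfK D K)).Label) (v : (thetaIndex (pilotDataOfK D K)).V),
    Set ((logShellsDH (pilotDataOfK D K) logv).Packet j ((thetaIndex (pilotDataOfK D K)).over v)))
  (Ψ : ℤ → ∀ v : (thetaIndex (pilotDataOfK D K)).V, v ∈ (thetaIndex (pilotDataOfK D K)).Vbad →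
    Set ((logShellsDH (pilotDataOfK D K) logv).StarPacket v))
  (act : ℤ → ∀ v : (thetaIndex (pilotDataOfK D K)).V, v ∈ (thetaIndex (pilotDataOfK D K)).Vbad →
    (logShellsDH (pilotDataOfK D K) logv).StarPacket v → Module.End ℚ ((logShellsDH (pilotDataOfK D K) logv).StarPacket v))
  (Mmod : ℤ → ∀ j : (thetaIndex (pilotDataOfK D K)).LabelStar, Set ((logShellsDH (pilotDataOfK D K) logv).GlobalPacket j.1))
  (region : ℤ → ∀ j : (thetaIndex (pilotDataOfK D K)).LabelStar, FinDivisor M → ∀ vQ : (thetaIndex (pilotDataOfK D K)).VQ,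
    Set ((logShellsDH (pilotDataOfK D K) logv).Packet j.1 vQ))
  (n : ℤ) {HT : Type} {LogLink : HT → HT → Type} {IsFull : ∀ {s t : HT}, LogLink s t → Prop}
  (lat : LGPGaussianLogThetaLattice LogLink IsFull)
  {Frd : Type} {IsoF : Frd → Frd → Type} {Ob : Frd → Type} {realify : Frd → Frd} {Strip : Type}
  {IsoS : Strip → Strip → Type}
  {Mv : ∀ v : (thetaIndex (pilotDataOfK D K)).V, v ∈ (thetaIndex (pilotDataOfK D K)).Vbad → Type} [∀ v h, Monoid (Mv v h)]
  (sig : GlobalLGPFrobenioidSignature (thetaIndex (pilotDataOfK D K)).lstar (thetaIndex (pilotDataOfK D K)).V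
    (· ∈ (thetaIndex (pilotDataOfK D K)).Vbad) Frd IsoF Ob realify Strip IsoS Mv)
  (split : SplittingMonoids Mv) {ObΔ : Type}
  {N : ∀ v : (thetaIndex (pilotDataOfK D K)).V, v ∈ (thetaIndex (pilotDataOfK D K)).Vbad → Type} [∀ v h, Monoid (N v h)]
  (qData : QPilotData ObΔ N)
  (tq : ∀ (pp : Nat.Primes) (x : (thetaIndex (pilotDataOfK D K)).Fibre (.inr pp)),
    haveI : Fact (pp : ℕ).Prime := ⟨pp.2⟩; kOf (pilotDataOfK D K) pp.1 x)
  (t : ∀ (pp : Nat.Primes) (_ : Fin (pilotDataOfK D K).lstar) (x : (thetaIndex (pilotDataOfK D K)).Fibre (.inr pp)),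
    haveI : Fact (pp : ℕ).Prime := ⟨pp.2⟩; kOf (pilotDataOfK D K) pp.1 x)
  (htq0 : ∀ pp x, tq pp x ≠ 0)
  (htq1 : ∀ (pp : Nat.Primes) (x : (thetaIndex (pilotDataOfK D K)).Fibre (.inr pp)),
    haveI : Fact (pp : ℕ).Prime := ⟨pp.2⟩; placeOf (pilotDataOfK D K) pp.1 x ∉ (pilotDataOfK D K).S → ‖tq pp x‖ = 1)
  (ht0 : ∀ pp i x, t pp i x ≠ 0)
  (ht1 : ∀ (pp : Nat.Primes) (i : Fin (pilotDataOfK D K).lstar) (x : (thetaIndex (pilotDataOfK D K)).Fibre (.inr pp)),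
    haveI : Fact (pp : ℕ).Prime := ⟨pp.2⟩; placeOf (pilotDataOfK D K) pp.1 x ∉ (pilotDataOfK D K).S → ‖t pp i x‖ = 1)
  (ht : ∀ (pp : Nat.Primes) (i : Fin (pilotDataOfK D K).lstar) (x : (thetaIndex (pilotDataOfK D K)).Fibre (.inr pp)),
    haveI : Fact (pp : ℕ).Prime := ⟨pp.2⟩
    Real.log ‖t pp i x‖ = -((pilotDataOfK D K).thetaPilot i (placeOf (pilotDataOfK D K) pp.1 x)) *
      logNorm K (placeOf (pilotDataOfK D K) pp.1 x) / localDegree K (placeOf (pilotDataOfK D K) pp.1 x))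
  (htq : ∀ (pp : Nat.Primes) (x : (thetaIndex (pilotDataOfK D K)).Fibre (.inr pp)),
    haveI : Fact (pp : ℕ).Prime := ⟨pp.2⟩
    Real.log ‖tq pp x‖ = -((pilotDataOfK D K).qPilot (placeOf (pilotDataOfK D K) pp.1 x)) *
      logNorm K (placeOf (pilotDataOfK D K) pp.1 x) / localDegree K (placeOf (pilotDataOfK D K) pp.1 x))
  (mq : ∀ pp : Nat.Primes, (thetaIndex (pilotDataOfK D K)).Fibre (.inr pp) → ℤ)

include ht0 ht1 ht htq in
/-- **THE ROW-27 DOOR AT THE GENUINE BED with (O″) owed ONLY at the bad primes `p ≢ 3 (mod 4)`** — abc-iut-rh2-L1's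
`ReachLedgerDoor.statement_pilotDataOfK_of_hStarReachLedgerK_of_innerOuterUnit` (p483260) VERBATIM, except that its hypothesis (O″)
«`e_p ≠ p^a(p−1)` for all `a`, or per place `x ∣ p`: `f(𝔭_x∣p) ≥ 2` or some `π ∈ K_x` with `‖π‖ = p^{−1/e_p}` and `‖1 + π^{e_p}/p‖ = 1`»
is asked only at the bad primes `p` with `p % 4 ≠ 3`: at `p ≡ 3 (mod 4)` it holds by §2 (`√−1 ∈ K` ⇒ `f ≥ 2` at every `x ∣ p`).
H⋆₂₇ is a HYPOTHESIS; «Statement follows from the ledger AS TYPED»; no side taken on [IUTchIII] Cor. 3.12.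
[cite: Mochizuki2012, IUTchI Def. 3.1 (a),(b) p. 61, Ex. 3.2 (iv) p. 71; IUTchIII Cor. 3.12 p. 173–174] [cite: NeukirchANT1999, Ch. I §8,
Ch. II (5.5)–(5.7), Prop. (6.8)] [cite: DupuyHilado2025, §3.3, §3.4, §3.9, §4.9] [claim: Mochizuki2012, status: disputed] -/
theorem statement_pilotDataOfK_of_hStarReachLedgerK_of_innerOuterUnit_modFour (eK : Nat.Primes → ℕ)
    (heK : ∀ (pp : Nat.Primes) (w : (thetaIndex (pilotDataOfK D K)).Fibre (.inr pp)), haveI : Fact (pp : ℕ).Prime := ⟨pp.2⟩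
      placeOf (pilotDataOfK D K) pp.1 w ∈ (pilotDataOfK D K).S → ∀ x : (thetaIndex (pilotDataOfK D K)).Fibre (.inr pp),
        (placeOf (pilotDataOfK D K) pp.1 x).asIdeal.ramificationIdx ℤ = eK pp)
    (hI : ∀ (pp : Nat.Primes) (w : (thetaIndex (pilotDataOfK D K)).Fibre (.inr pp)), haveI : Fact (pp : ℕ).Prime := ⟨pp.2⟩
      placeOf (pilotDataOfK D K) pp.1 w ∈ (pilotDataOfK D K).S → (pp : ℕ) ≠ 2 ∨ ¬ 2 ∣ eK pp)
    (hO : ∀ (pp : Nat.Primes) (w : (thetaIndex (pilotDataOfK D K)).Fibre (.inr pp)), haveI : Fact (pp : ℕ).Prime := ⟨pp.2⟩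
      placeOf (pilotDataOfK D K) pp.1 w ∈ (pilotDataOfK D K).S → (pp : ℕ) % 4 ≠ 3 →
        (∀ a : ℕ, (eK pp : ℤ) ≠ ((pp : ℕ) : ℤ) ^ a * (((pp : ℕ) : ℤ) - 1)) ∨
          ∀ x : (thetaIndex (pilotDataOfK D K)).Fibre (.inr pp), 2 ≤ (placeOf (pilotDataOfK D K) pp.1 x).asIdeal.inertiaDeg ℤ ∨
            ∃ π : kOf (pilotDataOfK D K) pp.1 x, ‖π‖ = ((pp : ℕ) : ℝ) ^ (-(1 : ℝ) / (eK pp : ℝ)) ∧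
              ‖1 + π ^ (eK pp) / ((pp : ℕ) : kOf (pilotDataOfK D K) pp.1 x)‖ = 1)
    (hmq : ∀ (pp : Nat.Primes) (w : (thetaIndex (pilotDataOfK D K)).Fibre (.inr pp)), haveI : Fact (pp : ℕ).Prime := ⟨pp.2⟩
      placeOf (pilotDataOfK D K) pp.1 w ∈ (pilotDataOfK D K).S →
        (mq pp w : ℝ) = (pilotDataOfK D K).qPilot (placeOf (pilotDataOfK D K) pp.1 w))
    (hH : HStarReachLedgerK D
      (fun pp x => haveI : Fact (pp : ℕ).Prime := ⟨pp.2⟩; (placeOf (pilotDataOfK D K) pp.1 x).asIdeal.ramificationIdx ℤ) mq) :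
    (settingPrVolSharp (pilotDataOfK D K) hlog M archPk archSub Ψ act Mmod region n lat sig split qData tq t htq0 htq1).Statement :=
  statement_pilotDataOfK_of_hStarReachLedgerK_of_innerOuterUnit D hlog M archPk archSub Ψ act Mmod region n lat sig split qData tq t
    htq0 htq1 ht0 ht1 ht htq mq eK heK hI
    (fun pp w hw => by
      by_cases h4 : (pp : ℕ) % 4 = 3
      · exact D.outerUnit_clause_of_mod_four_eq_three pp h4 (eK pp)
      · exact hO pp w hw h4)
    hmq hH

end Door

end Summit.ABC.IUTFork.Repair.RH.TieDecider

end
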